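import Literature.Geometry.Symplectic.PlanarContactBoundary
import HarnessLib

/-!
# Giroux's path of contact forms, I: the pointwise algebra of `α ∧ dα` on `ℝ³`

Topic `Literature/Geometry/Symplectic`.  First file of the proof of the named fact
`Literature.Geometry.Symplectic.GirouxContactPath` (Etnyre, *Lectures on open book
decompositions and contact structures*, Prop. 3.5 of the arXiv version = Prop. 3.18 of the
published version, with the computation in the proof of Lemma 3.3).

The statement of that fact measures contact-ness of a `1`-form `α` on a `3`-manifold by the
scalar `wedge₁₂ (α y) (dα y) u v w = (α ∧ dα)(u, v, w)` (`PlanarContactBoundary.lean`), a bare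
function of three tangent vectors read in one identification `T_yN = ℝ³`.  Everything in the
printed proof is a SIGN argument with such top-degree forms ("the first term is clearly positive
…, the second term is also positive …, the last term is non-negative").  This file supplies the
linear algebra that turns sign information on ONE frame into sign information on ALL frames:

* bilinearity of `wedge₁₂` and its behaviour under a linear change of frame
  (`wedge₁₂_compContinuousLinearMap`);
* `wedgeForm a b`, the same expression packaged as a continuous alternating `3`-form (it is
  Mathlib's `alternatizeUncurryFin` of `u ↦ a(u) • b`), `wedgeForm_apply`;
* every alternating `3`-form on `ℝ³` is its value on the standard basis times the determinant
  (`alt3_apply_eq_mul_det`, from `AlternatingMap.eq_smul_basis_det`), whence: two such forms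
  positive on one common frame are positive on the same frames (`alt3_pos_iff_pos_of_pos`), a
  nonzero form vanishes on no basis (`alt3_apply_ne_zero_of_linearIndependent`);
* the **adapted frame lemma** `exists_adapted_triple`: for a nonzero covector `f` (the angular
  differential `dθ` off the binding) and a nonzero alternating `3`-form `ω` (the contact
  condition) there is a frame `(n, u, v)` with `f n > 0`, `f u = f v = 0`, `ω (n, u, v) > 0` —
  the frame "normal vector, oriented basis of the page" on which the Giroux condition
  `dα|_{page} > 0` is stated.

Everything here is elementary and proved; no definitions of mathematical content beyond the
packaging `covector`, `wedgeForm`, `stdBasis3`.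

## References

* J. B. Etnyre, *Lectures on open book decompositions and contact structures*, Clay Math. Proc.
  5 (2006), proof of Lemma 3.3 and of Prop. 3.18 (arXiv:math/0409402: Lemma 3.3, Prop. 3.5).
  [Etnyre2006]
-/

noncomputable section

open scoped Manifold ContDiff Topology
open Set Function

namespace Literature.Geometry.Symplectic

/-- Local notation: `𝔼 n` is the model Euclidean space `EuclideanSpace ℝ (Fin n)`. -/
local notation "𝔼 " n:arg => EuclideanSpace ℝ (Fin n)

/-! ### Bilinearity of `wedge₁₂` and change of frame -/

section Bilinear

variable (a a' : (𝔼 3) [⋀^Fin 1]→L[ℝ] ℝ) (b b' : (𝔼 3) [⋀^Fin 2]→L[ℝ] ℝ)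

/-- `wedge₁₂` is additive in the `1`-form. [folklore] -/
theorem wedge₁₂_add_left (u v w : 𝔼 3) :
    wedge₁₂ (a + a') b u v w = wedge₁₂ a b u v w + wedge₁₂ a' b u v w := by
  simp only [wedge₁₂, ContinuousAlternatingMap.add_apply]
  ring

/-- `wedge₁₂` is homogeneous in the `1`-form. [folklore] -/
theorem wedge₁₂_smul_left (c : ℝ) (u v w : 𝔼 3) :
    wedge₁₂ (c • a) b u v w = c * wedge₁₂ a b u v w := by
  simp only [wedge₁₂, ContinuousAlternatingMap.smul_apply, smul_eq_mul]
  ring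

/-- `wedge₁₂` is additive in the `2`-form. [folklore] -/
theorem wedge₁₂_add_right (u v w : 𝔼 3) :
    wedge₁₂ a (b + b') u v w = wedge₁₂ a b u v w + wedge₁₂ a b' u v w := by
  simp only [wedge₁₂, ContinuousAlternatingMap.add_apply]
  ring

/-- `wedge₁₂` is homogeneous in the `2`-form. [folklore] -/
theorem wedge₁₂_smul_right (c : ℝ) (u v w : 𝔼 3) :
    wedge₁₂ a (c • b) u v w = c * wedge₁₂ a b u v w := by
  simp only [wedge₁₂, ContinuousAlternatingMap.smul_apply, smul_eq_mul]
  ring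

/-- The wedge with the zero `2`-form vanishes. [folklore] -/
@[simp] theorem wedge₁₂_zero_right (u v w : 𝔼 3) : wedge₁₂ a 0 u v w = 0 := by
  simp [wedge₁₂]

/-- **Change of frame.** Pulling both forms back along a linear map `T` (e.g. the differential
of a local parametrisation) is the same as evaluating on the image frame:
`(T^*a ∧ T^*b)(u, v, w) = (a ∧ b)(Tu, Tv, Tw)`. [folklore] -/
theorem wedge₁₂_compContinuousLinearMap (T : (𝔼 3) →L[ℝ] (𝔼 3)) (u v w : 𝔼 3) :
    wedge₁₂ (a.compContinuousLinearMap T) (b.compContinuousLinearMap T) u v w =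
      wedge₁₂ a b (T u) (T v) (T w) := by
  have h1 : ∀ x : 𝔼 3, (T ∘ ![x] : Fin 1 → 𝔼 3) = ![T x] := fun x => by
    funext i; fin_cases i; rfl
  have h2 : ∀ x y : 𝔼 3, (T ∘ ![x, y] : Fin 2 → 𝔼 3) = ![T x, T y] := fun x y => by
    funext i; fin_cases i <;> rfl
  simp only [wedge₁₂, ContinuousAlternatingMap.compContinuousLinearMap_apply, h1, h2]

end Bilinear

/-! ### `wedge₁₂` as an alternating `3`-form; proportionality to the determinant -/

section Alternating

/-- The covector `u ↦ a(u)` of a `1`-form `a` (inverse of Mathlib's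
`ContinuousAlternatingMap.ofSubsingleton`). [folklore] -/
def covector (a : (𝔼 3) [⋀^Fin 1]→L[ℝ] ℝ) : (𝔼 3) →L[ℝ] ℝ :=
  (ContinuousAlternatingMap.ofSubsingleton ℝ (𝔼 3) ℝ (0 : Fin 1)).symm a

/-- `covector a u = a(u)`. [folklore] -/
@[simp] theorem covector_apply (a : (𝔼 3) [⋀^Fin 1]→L[ℝ] ℝ) (u : 𝔼 3) :
    covector a u = a ![u] := by
  have h : (fun _ : Fin 1 => u) = ![u] := by funext i; fin_cases i; rfl
  simp [covector, h]

/-- **`a ∧ b` as a continuous alternating `3`-form on `ℝ³`**: Mathlib's alternatisation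
`alternatizeUncurryFin` of the linear map `u ↦ a(u) • b`, whose defining sum
`∑ᵢ (-1)^i a(vᵢ) b(v₀, …, v̂ᵢ, …, v₂)` is literally the formula of `wedge₁₂`
(`wedgeForm_apply`). [folklore] -/
def wedgeForm (a : (𝔼 3) [⋀^Fin 1]→L[ℝ] ℝ) (b : (𝔼 3) [⋀^Fin 2]→L[ℝ] ℝ) :
    (𝔼 3) [⋀^Fin 3]→L[ℝ] ℝ :=
  ContinuousAlternatingMap.alternatizeUncurryFin ((covector a).smulRight b)

/-- `wedgeForm a b (u, v, w) = wedge₁₂ a b u v w`. [folklore] -/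
@[simp] theorem wedgeForm_apply (a : (𝔼 3) [⋀^Fin 1]→L[ℝ] ℝ) (b : (𝔼 3) [⋀^Fin 2]→L[ℝ] ℝ)
    (u v w : 𝔼 3) : wedgeForm a b ![u, v, w] = wedge₁₂ a b u v w := by
  have h0 : Fin.removeNth (0 : Fin 3) (![u, v, w] : Fin 3 → 𝔼 3) = ![v, w] := by
    funext i; fin_cases i <;> rfl
  have h1 : Fin.removeNth (1 : Fin 3) (![u, v, w] : Fin 3 → 𝔼 3) = ![u, w] := by
    funext i; fin_cases i <;> rfl
  have h2 : Fin.removeNth (2 : Fin 3) (![u, v, w] : Fin 3 → 𝔼 3) = ![u, v] := by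
    funext i; fin_cases i <;> rfl
  rw [wedgeForm, ContinuousAlternatingMap.alternatizeUncurryFin_apply, Fin.sum_univ_three, h0, h1,
    h2]
  simp [wedge₁₂, covector_apply, pow_succ]
  ring

/-- The standard basis of `ℝ³` (Mathlib's `EuclideanSpace.basisFun`, as a `Module.Basis`).
[folklore] -/
def stdBasis3 : Module.Basis (Fin 3) ℝ (𝔼 3) :=
  (EuclideanSpace.basisFun (Fin 3) ℝ).toBasis

/-- The standard basis vectors are the `EuclideanSpace.single j 1`. [folklore] -/
theorem stdBasis3_apply (j : Fin 3) : stdBasis3 j = EuclideanSpace.single j (1 : ℝ) := by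
  classical
  rw [stdBasis3, OrthonormalBasis.coe_toBasis, EuclideanSpace.basisFun_apply]

/-- The standard basis, as a frame, is `(e₀, e₁, e₂)`. [folklore] -/
theorem coe_stdBasis3_eq : (⇑stdBasis3 : Fin 3 → 𝔼 3) = ![stdBasis3 0, stdBasis3 1, stdBasis3 2] := by
  funext i; fin_cases i <;> rfl

/-- **An alternating `3`-form on `ℝ³` is its value on the standard basis times the
determinant** (Mathlib's `AlternatingMap.eq_smul_basis_det`). [folklore] -/
theorem alt3_apply_eq_mul_det (f : (𝔼 3) [⋀^Fin 3]→L[ℝ] ℝ) (t : Fin 3 → 𝔼 3) :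
    f t = f stdBasis3 * stdBasis3.det t := by
  have h := f.toAlternatingMap.eq_smul_basis_det stdBasis3
  have h' := congrArg (fun g : (𝔼 3) [⋀^Fin 3]→ₗ[ℝ] ℝ => g t) h
  simpa using h'

/-- Sign bookkeeping for `alt3_pos_iff_pos_of_pos`: if `c d₀ > 0` and `c' d₀ > 0` then `c d` and
`c' d` have the same strict sign for every `d`. [folklore] -/
theorem sameSign_mul_aux {c c' d₀ : ℝ} (h : 0 < c * d₀) (h' : 0 < c' * d₀) (d : ℝ) :
    (0 < c * d ↔ 0 < c' * d) ∧ (c * d < 0 ↔ c' * d < 0) := by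
  have hd₀ : d₀ ≠ 0 := by rintro rfl; simp at h
  have hd₀2 : 0 < d₀ ^ 2 := by positivity
  have hcc : 0 < c * c' := by
    have hm : 0 < (c * c') * d₀ ^ 2 := by
      have := mul_pos h h'
      calc (0 : ℝ) < c * d₀ * (c' * d₀) := this
        _ = (c * c') * d₀ ^ 2 := by ring
    exact (mul_pos_iff_of_pos_right hd₀2).1 hm
  by_cases hd : d = 0
  · subst hd; simp
  have hd2 : 0 < d ^ 2 := by positivity
  have hprod : 0 < (c * d) * (c' * d) := by
    calc (0 : ℝ) < (c * c') * d ^ 2 := mul_pos hcc hd2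
      _ = (c * d) * (c' * d) := by ring
  refine ⟨⟨fun h1 => ?_, fun h1 => ?_⟩, ⟨fun h1 => ?_, fun h1 => ?_⟩⟩
  · exact (mul_pos_iff_of_pos_left h1).1 hprod
  · exact (mul_pos_iff_of_pos_right h1).1 hprod
  · by_contra h2
    push Not at h2
    nlinarith [mul_nonneg_of_nonpos_of_nonpos h1.le (le_refl 0)]
  · by_contra h2
    push Not at h2
    nlinarith

/-- Two alternating `3`-forms on `ℝ³` which are positive on one common frame are positive on
exactly the same frames (both are positive multiples of the same determinant). [folklore] -/
theorem alt3_pos_iff_pos_of_pos {f g : (𝔼 3) [⋀^Fin 3]→L[ℝ] ℝ} {t₀ : Fin 3 → 𝔼 3}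
    (hf : 0 < f t₀) (hg : 0 < g t₀) (t : Fin 3 → 𝔼 3) : 0 < f t ↔ 0 < g t := by
  rw [alt3_apply_eq_mul_det f] at hf ⊢
  rw [alt3_apply_eq_mul_det g] at hg ⊢
  exact (sameSign_mul_aux hf hg _).1

/-- Two alternating `3`-forms on `ℝ³` which are positive on one common frame have the same sign
on every frame: negativity version of `alt3_pos_iff_pos_of_pos`. [folklore] -/
theorem alt3_neg_iff_neg_of_pos {f g : (𝔼 3) [⋀^Fin 3]→L[ℝ] ℝ} {t₀ : Fin 3 → 𝔼 3}
    (hf : 0 < f t₀) (hg : 0 < g t₀) (t : Fin 3 → 𝔼 3) : f t < 0 ↔ g t < 0 := by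
  rw [alt3_apply_eq_mul_det f] at hf ⊢
  rw [alt3_apply_eq_mul_det g] at hg ⊢
  exact (sameSign_mul_aux hf hg _).2

/-- A form positive somewhere does not vanish on the standard basis. [folklore] -/
theorem alt3_apply_stdBasis3_ne_zero {f : (𝔼 3) [⋀^Fin 3]→L[ℝ] ℝ} {t₀ : Fin 3 → 𝔼 3}
    (hf : f t₀ ≠ 0) : f stdBasis3 ≠ 0 := by
  intro h
  rw [alt3_apply_eq_mul_det f, h, zero_mul] at hf
  exact hf rfl

/-- **A nonzero alternating `3`-form on `ℝ³` vanishes on no basis.** [folklore] -/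
theorem alt3_apply_ne_zero_of_linearIndependent {f : (𝔼 3) [⋀^Fin 3]→L[ℝ] ℝ} {t₀ : Fin 3 → 𝔼 3}
    (hf : f t₀ ≠ 0) {t : Fin 3 → 𝔼 3} (ht : LinearIndependent ℝ t) : f t ≠ 0 := by
  have hcard : Fintype.card (Fin 3) = Module.finrank ℝ (𝔼 3) := by simp
  set B := basisOfLinearIndependentOfCardEqFinrank ht hcard with hB
  have hBt : (⇑B : Fin 3 → 𝔼 3) = t := coe_basisOfLinearIndependentOfCardEqFinrank ht hcard
  have hdet : stdBasis3.det t ≠ 0 := by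
    rw [← hBt]
    exact (stdBasis3.isUnit_det B).ne_zero
  rw [alt3_apply_eq_mul_det]
  exact mul_ne_zero (alt3_apply_stdBasis3_ne_zero hf) hdet

/-- The standard basis is linearly independent (for use with
`alt3_apply_ne_zero_of_linearIndependent`). [folklore] -/
theorem linearIndependent_stdBasis3 :
    LinearIndependent ℝ (![stdBasis3 0, stdBasis3 1, stdBasis3 2] : Fin 3 → 𝔼 3) := by
  rw [← coe_stdBasis3_eq]
  exact stdBasis3.linearIndependent

/-- A form nonzero somewhere is nonzero on the standard frame `(e₀, e₁, e₂)`. [folklore] -/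
theorem alt3_apply_std_ne_zero {f : (𝔼 3) [⋀^Fin 3]→L[ℝ] ℝ} {t₀ : Fin 3 → 𝔼 3} (hf : f t₀ ≠ 0) :
    f ![stdBasis3 0, stdBasis3 1, stdBasis3 2] ≠ 0 :=
  alt3_apply_ne_zero_of_linearIndependent hf linearIndependent_stdBasis3

/-- **Convex combinations keep the sign.** If `L₀` and `L₁` both have the sign of `f` on the
frame `t` (in the sense of `alt3_pos_iff_pos_of_pos`: each is positive together with `f`,
respectively with a form `f'` positive on the same frames as `f`, on some frame) and `f t ≠ 0`,
then `(1 - s) L₀ t + s L₁ t ≠ 0` for `s ∈ [0, 1]`. This is the pointwise heart of "for `R` large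
`s α_{1R} + (1 - s) α_{0R}` is contact". [folklore] -/
theorem convexComb_ne_zero_of_sameSign {f f' L₀ L₁ : (𝔼 3) [⋀^Fin 3]→L[ℝ] ℝ}
    (hff' : ∀ t, 0 < f t ↔ 0 < f' t) {t₀ t₁ : Fin 3 → 𝔼 3}
    (h₀ : 0 < f t₀) (hL₀ : 0 < L₀ t₀) (h₁ : 0 < f' t₁) (hL₁ : 0 < L₁ t₁)
    {t : Fin 3 → 𝔼 3} (ht : f t ≠ 0) {s : ℝ} (hs : s ∈ Icc (0 : ℝ) 1) :
    (1 - s) * L₀ t + s * L₁ t ≠ 0 := by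
  rcases lt_or_gt_of_ne ht with hneg | hpos
  · -- `f t < 0`: both `L₀ t`, `L₁ t` are negative
    have hL₀t : L₀ t < 0 := (alt3_neg_iff_neg_of_pos h₀ hL₀ t).1 hneg
    have hf't : f' t < 0 := by
      have h1 : ¬ 0 < f' t := fun h => (lt_irrefl _ (((hff' t).2 h).trans hneg))
      have h2 : f' t ≠ 0 := by
        intro h0
        -- `f'` vanishes on the frame `t`, so `t` is not a basis, so `f t = 0`: contradiction
        have key : f t = 0 := by
          rw [alt3_apply_eq_mul_det f]
          rw [alt3_apply_eq_mul_det f'] at h0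
          rcases mul_eq_zero.1 h0 with h | h
          · exact absurd h (alt3_apply_stdBasis3_ne_zero (ne_of_gt h₁))
          · rw [h, mul_zero]
        exact ht key
      exact lt_of_le_of_ne (not_lt.1 h1) h2
    have hL₁t : L₁ t < 0 := (alt3_neg_iff_neg_of_pos h₁ hL₁ t).1 hf't
    have : (1 - s) * L₀ t + s * L₁ t < 0 := by
      rcases eq_or_lt_of_le hs.1 with rfl | hs0
      · simpa using hL₀t
      · nlinarith [hs.2]
    exact ne_of_lt this
  · have hL₀t : 0 < L₀ t := (alt3_pos_iff_pos_of_pos h₀ hL₀ t).1 hpos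
    have hL₁t : 0 < L₁ t := (alt3_pos_iff_pos_of_pos h₁ hL₁ t).1 ((hff' t).1 hpos)
    have : 0 < (1 - s) * L₀ t + s * L₁ t := by
      rcases eq_or_lt_of_le hs.1 with rfl | hs0
      · simpa using hL₀t
      · nlinarith [hs.2]
    exact ne_of_gt this

end Alternating

/-! ### The adapted frame -/

section Adapted

/-- **The adapted frame lemma.** For a nonzero covector `f` on `ℝ³` and an alternating `3`-form
`φ` that does not vanish identically, there is a frame `(n, u, v)` with `f n > 0`,
`f u = f v = 0` and `φ (n, u, v) > 0`: take a basis `(u, v)` of `ker f` (of dimension `2`), any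
`n` with `f n > 0`, and swap `u, v` if necessary. [folklore] -/
theorem exists_adapted_triple (f : (𝔼 3) →L[ℝ] ℝ) (hf : f ≠ 0) {φ : (𝔼 3) [⋀^Fin 3]→L[ℝ] ℝ}
    {t₀ : Fin 3 → 𝔼 3} (hφ : φ t₀ ≠ 0) :
    ∃ n u v : 𝔼 3, 0 < f n ∧ f u = 0 ∧ f v = 0 ∧ 0 < φ ![n, u, v] := by
  -- a vector with `f n > 0`
  obtain ⟨n₀, hn₀⟩ : ∃ n₀, f n₀ ≠ 0 := by
    by_contra h
    push Not at h
    exact hf (ContinuousLinearMap.ext h)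
  obtain ⟨n, hn⟩ : ∃ n, 0 < f n := by
    rcases lt_or_gt_of_ne hn₀ with h | h
    · exact ⟨-n₀, by simpa using h⟩
    · exact ⟨n₀, h⟩
  -- `ker f` has dimension `2`
  set fl : (𝔼 3) →ₗ[ℝ] ℝ := (f : (𝔼 3) →ₗ[ℝ] ℝ) with hfl
  have hrange : LinearMap.range fl = ⊤ := by
    refine LinearMap.range_eq_top.2 fun c => ⟨(c / f n) • n, ?_⟩
    simp only [hfl, ContinuousLinearMap.coe_coe, map_smul, smul_eq_mul]
    field_simp
  have hker : Module.finrank ℝ (LinearMap.ker fl) = 2 := by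
    have h := LinearMap.finrank_range_add_finrank_ker fl
    rw [hrange, finrank_top, Module.finrank_self, finrank_euclideanSpace_fin] at h
    omega
  set bK := Module.finBasisOfFinrankEq ℝ (LinearMap.ker fl) hker with hbK
  set u : 𝔼 3 := ((bK 0 : LinearMap.ker fl) : 𝔼 3) with hu
  set v : 𝔼 3 := ((bK 1 : LinearMap.ker fl) : 𝔼 3) with hv
  have hfu : f u = 0 := by
    have := (bK 0).2
    rwa [LinearMap.mem_ker] at this
  have hfv : f v = 0 := by
    have := (bK 1).2
    rwa [LinearMap.mem_ker] at this
  -- `(n, u, v)` is linearly independent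
  have hli : LinearIndependent ℝ (![n, u, v] : Fin 3 → 𝔼 3) := by
    rw [Fintype.linearIndependent_iff]
    intro g hg
    rw [Fin.sum_univ_three] at hg
    simp only [Matrix.cons_val_zero, Matrix.cons_val_one, Matrix.cons_val] at hg
    have hg0 : g 0 = 0 := by
      have h := congrArg f hg
      simp only [map_add, map_smul, smul_eq_mul, hfu, hfv, mul_zero, add_zero, map_zero] at h
      rcases mul_eq_zero.1 h with h | h
      · exact h
      · exact absurd h (ne_of_gt hn)
    rw [hg0, zero_smul, zero_add] at hg
    -- independence of `bK 0, bK 1` in the kernel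
    have hK : g 1 • bK 0 + g 2 • bK 1 = 0 := by
      apply Subtype.ext
      simpa [hu, hv] using hg
    have hind := Fintype.linearIndependent_iff.1 bK.linearIndependent ![g 1, g 2] (by
      rw [Fin.sum_univ_two]
      simpa using hK)
    have hg1 : g 1 = 0 := by simpa using hind 0
    have hg2 : g 2 = 0 := by simpa using hind 1
    intro i
    fin_cases i
    · exact hg0
    · exact hg1
    · exact hg2
  have hne : φ ![n, u, v] ≠ 0 := alt3_apply_ne_zero_of_linearIndependent hφ hli
  rcases lt_or_gt_of_ne hne with hlt | hgt
  · refine ⟨n, v, u, hn, hfv, hfu, ?_⟩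
    have hswap : φ ![n, v, u] = -φ ![n, u, v] := by
      have h := φ.map_swap (v := ![n, u, v]) (i := 1) (j := 2) (by decide)
      have e : (![n, u, v] : Fin 3 → 𝔼 3) ∘ Equiv.swap (1 : Fin 3) 2 = ![n, v, u] := by
        funext i; fin_cases i <;> rfl
      rw [← e]
      exact h
    rw [hswap]
    linarith
  · exact ⟨n, u, v, hn, hfu, hfv, hgt⟩

end Adapted


/-! ### Linearity in the frame vectors -/

section FrameLinear

/-- A `1`-form is homogeneous in its vector: `a(c • v) = c · a(v)`. [folklore] -/
theorem oneForm_apply_smul_vec (a : (𝔼 3) [⋀^Fin 1]→L[ℝ] ℝ) (c : ℝ) (v : 𝔼 3) :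
    a ![c • v] = c * a ![v] := by
  rw [← covector_apply, ← covector_apply, map_smul, smul_eq_mul]

/-- A `2`-form is homogeneous in its first vector. [folklore] -/
theorem twoForm_apply_smul_left (b : (𝔼 3) [⋀^Fin 2]→L[ℝ] ℝ) (c : ℝ) (u v : 𝔼 3) :
    b ![c • u, v] = c * b ![u, v] :=
  (b.toAlternatingMap.map_vecCons_smul ![v] c u).trans (smul_eq_mul _ _)

/-- A `2`-form is homogeneous in its second vector. [folklore] -/
theorem twoForm_apply_smul_right (b : (𝔼 3) [⋀^Fin 2]→L[ℝ] ℝ) (c : ℝ) (u v : 𝔼 3) :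
    b ![u, c • v] = c * b ![u, v] := by
  have h1 : b ![u, c • v] = -b ![c • v, u] := by
    have h := b.toAlternatingMap.map_swap ![c • v, u] (show (0 : Fin 2) ≠ 1 by decide)
    have e : (![c • v, u] : Fin 2 → 𝔼 3) ∘ Equiv.swap (0 : Fin 2) 1 = ![u, c • v] := by
      funext i; fin_cases i <;> rfl
    rw [e] at h
    exact h
  have h2 : b ![u, v] = -b ![v, u] := by
    have h := b.toAlternatingMap.map_swap ![v, u] (show (0 : Fin 2) ≠ 1 by decide)
    have e : (![v, u] : Fin 2 → 𝔼 3) ∘ Equiv.swap (0 : Fin 2) 1 = ![u, v] := by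
      funext i; fin_cases i <;> rfl
    rw [e] at h
    exact h
  rw [h1, h2, twoForm_apply_smul_left]
  ring

/-- **`wedge₁₂` is homogeneous in its first frame vector**: `(a ∧ b)(c u, v, w) = c (a ∧ b)(u, v, w)`
(used to compare the frame `d(param) e₀ = c • ∂_ψ` with `∂_ψ`). [folklore] -/
theorem wedge₁₂_smul_first (a : (𝔼 3) [⋀^Fin 1]→L[ℝ] ℝ) (b : (𝔼 3) [⋀^Fin 2]→L[ℝ] ℝ) (c : ℝ)
    (u v w : 𝔼 3) : wedge₁₂ a b (c • u) v w = c * wedge₁₂ a b u v w := by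
  simp only [wedge₁₂, oneForm_apply_smul_vec, twoForm_apply_smul_left]
  ring

end FrameLinear

end Literature.Geometry.Symplectic

end
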